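import Mathlib
import HarnessLib

/-!
# ValiantsHypothesis / MonotoneRestoration — `MonotoneRestorationQP`, line `Sketch`, stub D5

Support file for crux item `stmt-ValiantsHypothesis-15886`
(`Summit.ValiantsHypothesis.ValiantsHypothesis.Theses.MonotoneRestoration.MonotoneRestorationQP`),
line `Sketch`, stub `stub_esymmRowSums_scan`: the sanity instance of Theorem δ (commuting row
scans) — the elementary symmetric polynomial `e_k` of the row sums `R_i = Σ_j x_{i j}` is the value
of a commuting scan of width `k + 1`.

With the template `H a b = [a = b] + [a = b + 1] · z₀` and `z₀ ↦ p₁(r_i) = R_i`, the transfer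
matrix of row `i` is `A_i = I + R_i • N`, `N` the lower shift matrix (`N a b = [a = b + 1]`).

* The `A_i` pairwise commute: each is `1 + (scalar) • N` (`Commute` API).
* `A_0 ⋯ A_{n-1} = Σ_{t ⊆ [n]} (∏_{i ∈ t} R_i) • N ^ |t|`: all factors are values of the
  `S`-algebra map `Polynomial.aeval N` (`S` the coefficient polynomial ring), under which the
  ordered `List.prod` becomes a `Finset.prod` in the commutative ring `S[X]`, expanded by
  `Finset.prod_one_add`.
* `(N ^ d) a b = [a = b + d]`, so the `(k, 0)` entry — the one selected by `u = δ_k`, `v = δ_0` —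
  is `Σ_{|t| = k} ∏_{i ∈ t} R_i = bind₁ R (esymm (Fin n) ℂ k)`.
-/

-- `Summit.ValiantsHypothesis.ValiantsHypothesis.…` is the tree's mandated single-conjunct layout
-- (Sub = Summit), so the duplicated namespace component is intended.
set_option linter.dupNamespace false

noncomputable section

namespace Summit.ValiantsHypothesis.ValiantsHypothesis.Theorems

open MvPolynomial

/-- Powers of the lower shift matrix: `(N ^ d) a b = [a = b + d]`. [folklore] -/
theorem esymmRowSumsScan_shift_pow_apply {S : Type*} [Semiring S] (w d : ℕ) (a b : Fin w) :
    ((Matrix.of fun a b : Fin w => if (a : ℕ) = (b : ℕ) + 1 then (1 : S) else 0) ^ d) a b =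
      if (a : ℕ) = (b : ℕ) + d then 1 else 0 := by
  induction d generalizing a b with
  | zero =>
    rw [pow_zero, Matrix.one_apply, add_zero]
    simp only [Fin.ext_iff]
  | succ d ih =>
    rw [pow_succ, Matrix.mul_apply]
    simp_rw [ih, Matrix.of_apply, mul_ite, mul_one, mul_zero]
    by_cases hb : (b : ℕ) + 1 < w
    · rw [Finset.sum_eq_single ⟨(b : ℕ) + 1, hb⟩]
      · rw [if_pos rfl]
        exact if_congr (by dsimp only; omega) rfl rfl
      · intro c _ hc
        exact if_neg fun h => hc (Fin.ext h)
      · intro h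
        exact absurd (Finset.mem_univ _) h
    · rw [Finset.sum_eq_zero fun c _ => if_neg (by omega), if_neg (by omega)]

/-- An ordered product of the commuting matrices `1 + r_i • N` expands as
`Σ_{t ⊆ [n]} (∏_{i ∈ t} r_i) • N ^ |t|`. [folklore] -/
theorem esymmRowSumsScan_prod_one_add_smul {S : Type*} [CommRing S] {w n : ℕ}
    (N : Matrix (Fin w) (Fin w) S) (r : Fin n → S) :
    (List.ofFn fun i : Fin n => (1 : Matrix (Fin w) (Fin w) S) + r i • N).prod =
      ∑ t : Finset (Fin n), (∏ i ∈ t, r i) • N ^ t.card := by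
  have h1 : ∀ i : Fin n, (1 : Matrix (Fin w) (Fin w) S) + r i • N =
      Polynomial.aeval N (1 + Polynomial.C (r i) * Polynomial.X) := by
    intro i
    rw [map_add, map_one, map_mul, Polynomial.aeval_C, Polynomial.aeval_X, ← Algebra.smul_def]
  have h2 : (List.ofFn fun i : Fin n => (1 : Matrix (Fin w) (Fin w) S) + r i • N) =
      (List.ofFn fun i : Fin n =>
        (1 + Polynomial.C (r i) * Polynomial.X : Polynomial S)).map (Polynomial.aeval N) := by
    rw [← List.ofFn_comp']
    exact congrArg List.ofFn (funext h1)
  have h3 : ∀ t : Finset (Fin n),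
      (∏ i ∈ t, Polynomial.C (r i) * Polynomial.X : Polynomial S) =
        Polynomial.C (∏ i ∈ t, r i) * Polynomial.X ^ t.card := by
    intro t
    rw [Finset.prod_mul_distrib, Finset.prod_const, map_prod]
  rw [h2, ← map_list_prod, List.prod_ofFn, Finset.prod_one_add, Finset.powerset_univ, map_sum]
  refine Finset.sum_congr rfl fun t _ => ?_
  rw [h3, map_mul, map_pow, Polynomial.aeval_C, Polynomial.aeval_X, Algebra.smul_def]

/-- The indicator weights `u = δ_k`, `v = δ_0` select the `(k, 0)` entry. [folklore] -/
theorem esymmRowSumsScan_sum_indicator {σ R : Type*} [CommSemiring R] (k : ℕ)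
    (F : Matrix (Fin (k + 1)) (Fin (k + 1)) (MvPolynomial σ R)) :
    (∑ a : Fin (k + 1), ∑ b : Fin (k + 1),
      MvPolynomial.C (if (a : ℕ) = k then (1 : R) else 0) * F a b *
        MvPolynomial.C (if (b : ℕ) = 0 then (1 : R) else 0)) = F (Fin.last k) 0 := by
  rw [Finset.sum_eq_single (Fin.last k), Finset.sum_eq_single (0 : Fin (k + 1))]
  · simp
  · intro b _ hb
    have : (b : ℕ) ≠ 0 := fun h => hb (Fin.ext (by rw [h, Fin.val_zero]))
    simp [this]
  · intro h
    exact absurd (Finset.mem_univ _) h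
  · intro a _ ha
    have : (a : ℕ) ≠ k := fun h => ha (Fin.ext (by rw [h, Fin.val_last]))
    simp [this]
  · intro h
    exact absurd (Finset.mem_univ _) h

/-- **D5 — the definitions are right: `e_k` of the row sums is a commuting scan.** With
`w = k + 1`, `D = 1`, `H a b = [a = b] + [a = b + 1] · z_0` (so `A_i = I + p_1(r_i) N`, `N` the
lower shift), `u = δ_k`, `v = δ_0`: the `A_i` commute and the scan value
`Σ_{a,b} u_a (A_0 ⋯ A_{n-1})_{ab} v_b` is `e_k(R_0,…,R_{n-1})`. [folklore] -/
theorem stub_esymmRowSums_scan (n k : ℕ) :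
    (∀ i i' : Fin n,
      (Matrix.of fun a b : Fin (k + 1) => MvPolynomial.aeval
          (fun _ : Fin 1 => ∑ j : Fin n, (MvPolynomial.X (i, j) : MvPolynomial (Fin n × Fin n) ℂ)
            ^ ((0 : ℕ) + 1))
          ((if a = b then 1 else 0) + (if (a : ℕ) = (b : ℕ) + 1 then (MvPolynomial.X 0 : MvPolynomial (Fin 1) ℂ) else 0))) *
      (Matrix.of fun a b : Fin (k + 1) => MvPolynomial.aeval
          (fun _ : Fin 1 => ∑ j : Fin n, (MvPolynomial.X (i', j) : MvPolynomial (Fin n × Fin n) ℂ)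
            ^ ((0 : ℕ) + 1))
          ((if a = b then 1 else 0) + (if (a : ℕ) = (b : ℕ) + 1 then (MvPolynomial.X 0 : MvPolynomial (Fin 1) ℂ) else 0))) =
      (Matrix.of fun a b : Fin (k + 1) => MvPolynomial.aeval
          (fun _ : Fin 1 => ∑ j : Fin n, (MvPolynomial.X (i', j) : MvPolynomial (Fin n × Fin n) ℂ)
            ^ ((0 : ℕ) + 1))
          ((if a = b then 1 else 0) + (if (a : ℕ) = (b : ℕ) + 1 then (MvPolynomial.X 0 : MvPolynomial (Fin 1) ℂ) else 0))) *
      (Matrix.of fun a b : Fin (k + 1) => MvPolynomial.aeval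
          (fun _ : Fin 1 => ∑ j : Fin n, (MvPolynomial.X (i, j) : MvPolynomial (Fin n × Fin n) ℂ)
            ^ ((0 : ℕ) + 1))
          ((if a = b then 1 else 0) + (if (a : ℕ) = (b : ℕ) + 1 then (MvPolynomial.X 0 : MvPolynomial (Fin 1) ℂ) else 0)))) ∧
    (∑ a : Fin (k + 1), ∑ b : Fin (k + 1),
      MvPolynomial.C (if (a : ℕ) = k then (1 : ℂ) else 0) *
        (List.ofFn fun i : Fin n => Matrix.of fun a' b' : Fin (k + 1) => MvPolynomial.aeval
          (fun _ : Fin 1 => ∑ j : Fin n, (MvPolynomial.X (i, j) : MvPolynomial (Fin n × Fin n) ℂ)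
            ^ ((0 : ℕ) + 1))
          ((if a' = b' then 1 else 0) +
            (if (a' : ℕ) = (b' : ℕ) + 1 then (MvPolynomial.X 0 : MvPolynomial (Fin 1) ℂ) else 0))).prod a b *
        MvPolynomial.C (if (b : ℕ) = 0 then (1 : ℂ) else 0)) =
      MvPolynomial.bind₁ (fun i : Fin n => ∑ j : Fin n, MvPolynomial.X (i, j))
        (MvPolynomial.esymm (Fin n) ℂ k) := by
  -- every transfer matrix is `1 + R_i • N`
  have hA : ∀ i : Fin n,
      (Matrix.of fun a b : Fin (k + 1) => MvPolynomial.aeval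
          (fun _ : Fin 1 => ∑ j : Fin n, (MvPolynomial.X (i, j) : MvPolynomial (Fin n × Fin n) ℂ)
            ^ ((0 : ℕ) + 1))
          ((if a = b then 1 else 0) +
            (if (a : ℕ) = (b : ℕ) + 1 then (MvPolynomial.X 0 : MvPolynomial (Fin 1) ℂ) else 0))) =
        1 + (∑ j : Fin n, (MvPolynomial.X (i, j) : MvPolynomial (Fin n × Fin n) ℂ)) •
          Matrix.of fun a b : Fin (k + 1) =>
            if (a : ℕ) = (b : ℕ) + 1 then (1 : MvPolynomial (Fin n × Fin n) ℂ) else 0 := by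
    intro i
    ext a b
    simp only [Matrix.of_apply, Matrix.add_apply, Matrix.one_apply, Matrix.smul_apply, smul_eq_mul,
      mul_ite, mul_one, mul_zero, map_add]
    split_ifs <;> simp
  refine ⟨fun i i' => ?_, ?_⟩
  · rw [hA i, hA i']
    exact (Commute.add_left (Commute.one_left _) (Commute.add_right (Commute.one_right _)
      (((Commute.refl _).smul_left _).smul_right _))).eq
  · simp only [hA]
    rw [esymmRowSumsScan_prod_one_add_smul, esymmRowSumsScan_sum_indicator]
    simp only [Matrix.sum_apply, Matrix.smul_apply, smul_eq_mul,
      esymmRowSumsScan_shift_pow_apply, Fin.val_last, Fin.val_zero, zero_add, mul_ite, mul_one,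
      mul_zero]
    rw [← Finset.sum_filter]
    simp only [MvPolynomial.esymm, map_sum, map_prod, MvPolynomial.bind₁_X_right]
    exact Finset.sum_congr (by ext t; simp [Finset.mem_powersetCard, eq_comm]) fun _ _ => rfl

end Summit.ValiantsHypothesis.ValiantsHypothesis.Theorems
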